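import Summits.ValiantsHypothesis.ValiantsHypothesis.Theorems.FeketeSOSFeketeSOSHardPaleyRIPDefs
import Mathlib.NumberTheory.LegendreSymbol.Basic
import Mathlib.Algebra.Polynomial.Coeff
import Mathlib.Algebra.Polynomial.Basic
import Mathlib.Analysis.Complex.Basic

/-!
# Route FeketeSOS — crux `FeketeSOSHard` (stmt-ValiantsHypothesis-3996), line `paley-rip`,
# stub `stub_paleyMassIdentity`: the Paley mass identity `Σ_i c_i Q_p(g_i) = p − 1`

Registered stub 1 [provable] of the line of record `Cruxes/FeketeSOSHard/Lines/paley_rip.lean`, proved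
VERBATIM (objects `fek`, `paleyForm` from the line's definitions file
`Theorems/FeketeSOSFeketeSOSHardPaleyRIPDefs.lean`): for every cyclic representation
`X^p − 1 ∣ Σ_i c_i g_i² − F_p` over `ℂ` with `deg g_i < p`,

  `Σ_i c_i · Q_p(supp g_i, coeff g_i) = p − 1`,   `Q_p(S,w) = Σ_{a,b∈S} χ_p(a+b) w_a w_b`.

## Proof

Pair the representation with the Legendre symbol itself: the (Polynomial.lsum (fun e => (((legendreSym p e : ℤ) : ℂ)) • LinearMap.id) : ℂ[X] →ₗ[ℂ] ℂ)ED SUM `L(f) = Σ_e χ_p(e) · [X^e] f`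
(`twist`, a `ℂ`-linear functional, `Polynomial.lsum`) is `p`-PERIODIC in the exponent, so it kills every
multiple of `X^p − 1` (`twist_eq_zero_of_dvd`); on a square it is the Paley–Hankel form of the
coefficient vector (`twist_sq`: `L(g²) = Σ_{a,b} χ_p(a+b) g_a g_b`); and on the Fekete polynomial it is
`Σ_{m<p} χ_p(m)² = p − 1` (`twist_fek`). Hence `Σ_i c_i Q_p(g_i) = L(Σ c_i g_i²) = L(F_p) = p − 1`.
(The degree hypothesis is carried, not used: the identity holds for all `g_i`.)

With stub 4 (`stub_paleyCompletionBound`, the completion bound `|Q_p(S,w)| ≤ √p‖w‖²`) this gives the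
line's unconditional residue `massFloor_of` (archimedean mass `≥ (p−1)/√p`). Honest framing: the crux
`FeketeSOSHard` and the engine `stub_paleyFlatRIP` remain OPEN; nothing here bears on `VP ≠ VNP`.
-/

set_option linter.dupNamespace false

namespace Summit.ValiantsHypothesis.ValiantsHypothesis.Theorems.FeketeSOSHardPaleyRIP

open Polynomial Finset
open scoped BigOperators

noncomputable section

section Twist

variable (p : ℕ) [Fact p.Prime]

/-- `χ_p` is `p`-periodic (as a complex number on natural arguments). [folklore] -/
theorem chiC_add_p (e : ℕ) :
    ((legendreSym p ((e + p : ℕ) : ℤ) : ℤ) : ℂ) = ((legendreSym p (e : ℤ) : ℤ) : ℂ) := by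
  rw [legendreSym.mod p ((e + p : ℕ) : ℤ), legendreSym.mod p (e : ℤ)]
  push_cast
  rw [Int.add_emod_right]

/-- `χ_p(m)² = [p ∤ m]` for `m < p`: `χ_p(0) = 0` and `χ_p(m)² = 1` for `0 < m < p`. [folklore] -/
theorem chiC_mul_self {m : ℕ} (hm : m < p) :
    ((legendreSym p (m : ℤ) : ℤ) : ℂ) * ((legendreSym p (m : ℤ) : ℤ) : ℂ) = if m = 0 then 0 else 1 := by
  split_ifs with h
  · subst h
    simp [legendreSym.at_zero]
  · have hne : ((m : ℤ) : ZMod p) ≠ 0 := by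
      rw [Int.cast_natCast, Ne, ZMod.natCast_eq_zero_iff]
      exact fun hd => h (Nat.eq_zero_of_dvd_of_lt hd hm)
    have hsq := legendreSym.sq_one p hne
    rw [sq] at hsq
    exact_mod_cast hsq

/-! The (Polynomial.lsum (fun e => (((legendreSym p e : ℤ) : ℂ)) • LinearMap.id) : ℂ[X] →ₗ[ℂ] ℂ)ED SUM `L(f) = Σ_e χ_p(e) · f_e` is the `ℂ`-linear functional
`Polynomial.lsum (fun e => χ_p(e) • id)` on `ℂ[X]`; it is spelled out in every statement below. -/

/-- `L(c · X^e) = χ_p(e) · c`. [folklore] -/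
theorem twist_C_mul_X_pow (c : ℂ) (e : ℕ) :
    (Polynomial.lsum (fun e => (((legendreSym p e : ℤ) : ℂ)) • LinearMap.id) : ℂ[X] →ₗ[ℂ] ℂ) (C c * X ^ e) = ((legendreSym p (e : ℤ) : ℤ) : ℂ) * c := by
  rw [Polynomial.lsum_apply, Polynomial.C_mul_X_pow_eq_monomial,
    Polynomial.sum_monomial_index]
  · simp
  · simp

/-- Periodicity: `L(X^p · f) = L(f)`. [folklore] -/
theorem twist_X_pow_mul (f : ℂ[X]) : (Polynomial.lsum (fun e => (((legendreSym p e : ℤ) : ℂ)) • LinearMap.id) : ℂ[X] →ₗ[ℂ] ℂ) (X ^ p * f) = (Polynomial.lsum (fun e => (((legendreSym p e : ℤ) : ℂ)) • LinearMap.id) : ℂ[X] →ₗ[ℂ] ℂ) f := by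
  induction f using Polynomial.induction_on' with
  | add f g hf hg => rw [mul_add, map_add, map_add, hf, hg]
  | monomial e c =>
    rw [← Polynomial.C_mul_X_pow_eq_monomial, mul_comm (X ^ p), mul_assoc, ← pow_add,
      twist_C_mul_X_pow, twist_C_mul_X_pow, chiC_add_p]

/-- `L` kills the multiples of `X^p − 1`. [folklore] -/
theorem twist_eq_zero_of_dvd {f : ℂ[X]} (h : (X : ℂ[X]) ^ p - 1 ∣ f) : (Polynomial.lsum (fun e => (((legendreSym p e : ℤ) : ℂ)) • LinearMap.id) : ℂ[X] →ₗ[ℂ] ℂ) f = 0 := by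
  obtain ⟨q, rfl⟩ := h
  rw [sub_mul, one_mul, map_sub, twist_X_pow_mul, sub_self]

/-- On a square, `L` is the Paley–Hankel form of the coefficient vector:
`L(g²) = Σ_{a,b ∈ supp g} χ_p(a+b) g_a g_b`. [folklore] -/
theorem twist_sq (g : ℂ[X]) :
    (Polynomial.lsum (fun e => (((legendreSym p e : ℤ) : ℂ)) • LinearMap.id) : ℂ[X] →ₗ[ℂ] ℂ) (g ^ 2) = paleyForm p g.support (fun a => g.coeff a) := by
  have hg : g = ∑ a ∈ g.support, C (g.coeff a) * X ^ a := (as_sum_support_C_mul_X_pow g)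
  conv_lhs => rw [sq, hg, Finset.sum_mul]
  simp_rw [Finset.mul_sum]
  rw [map_sum]
  simp_rw [map_sum]
  unfold paleyForm
  refine Finset.sum_congr rfl fun a _ => Finset.sum_congr rfl fun b _ => ?_
  have hmul : C (g.coeff a) * X ^ a * (C (g.coeff b) * X ^ b) = C (g.coeff a * g.coeff b) * X ^ (a + b) := by
    rw [map_mul, pow_add]; ring
  rw [hmul, twist_C_mul_X_pow]
  push_cast
  ring

/-- On the Fekete polynomial: `L(F_p) = Σ_{m<p} χ_p(m)² = p − 1`. [folklore] -/
theorem twist_fek : (Polynomial.lsum (fun e => (((legendreSym p e : ℤ) : ℂ)) • LinearMap.id) : ℂ[X] →ₗ[ℂ] ℂ) (fek p) = (p : ℂ) - 1 := by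
  unfold fek
  rw [map_sum]
  have h : ∀ m ∈ range p, (Polynomial.lsum (fun e => (((legendreSym p e : ℤ) : ℂ)) • LinearMap.id) : ℂ[X] →ₗ[ℂ] ℂ) (C ((legendreSym p m : ℤ) : ℂ) * X ^ m) =
      if m = 0 then (0 : ℂ) else 1 := by
    intro m hm
    rw [twist_C_mul_X_pow]
    exact chiC_mul_self p (mem_range.1 hm)
  rw [Finset.sum_congr rfl h, Finset.sum_ite, Finset.sum_const_zero, zero_add, Finset.sum_const,
    nsmul_eq_mul, mul_one]
  have hp : 0 < p := (Fact.out : p.Prime).pos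
  have hcard : ((range p).filter fun m => ¬ m = 0).card = p - 1 := by
    rw [Finset.filter_ne', Finset.card_erase_of_mem (mem_range.2 hp), Finset.card_range]
  rw [hcard, Nat.cast_sub hp, Nat.cast_one]

end Twist

/-- **Stub 1 `stub_paleyMassIdentity` — the Paley mass identity** (line `paley-rip` of crux
`FeketeSOSHard`, stmt-ValiantsHypothesis-3996; registered signature verbatim): for a cyclic representation
`X^p − 1 ∣ Σ_i c_i g_i² − F_p` over `ℂ` (`deg g_i < p`), `Σ_i c_i · Q_p(supp g_i, coeff g_i) = p − 1`.
Proof: apply the `p`-periodic twisted sum `L = Σ_e χ_p(e)[X^e]`, which kills `(X^p − 1)·q`, maps `g²`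
to `Q_p(g)` and `F_p` to `Σ χ_p² = p − 1`. -/
theorem stub_paleyMassIdentity :
    ∀ (p : ℕ) [Fact p.Prime] (s : ℕ) (c : Fin s → ℂ) (g : Fin s → ℂ[X]),
      (∀ i, (g i).natDegree < p) →
      ((X : ℂ[X]) ^ p - 1 ∣ (∑ i, C (c i) * g i ^ 2) - fek p) →
      (∑ i, c i * paleyForm p (g i).support (fun a => (g i).coeff a)) = (p : ℂ) - 1 := by
  intro p _ s c g _hdeg hdvd
  have h0 := twist_eq_zero_of_dvd p hdvd
  rw [map_sub, sub_eq_zero, map_sum, twist_fek] at h0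
  rw [← h0]
  refine Finset.sum_congr rfl fun i _ => ?_
  rw [← twist_sq, ← smul_eq_mul, ← map_smul, smul_eq_C_mul]

end

end Summit.ValiantsHypothesis.ValiantsHypothesis.Theorems.FeketeSOSHardPaleyRIP
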